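import Literature.MathematicalPhysics.QuantumFieldTheory.Balaban1983to89.B13JointWalkExpansionAlgebra

/-!
# `Balaban1983to89.B13NeumannChains` — T. Bałaban, *Propagators for lattice gauge theories in a background field*, Commun.
Math. Phys. **99** (1985) 389–434 [Balaban1985BackgroundPropagators] («[13]» of [Balaban1988RG2Cluster]), (3.106) p. 414
*"G = G₀(I − R)⁻¹ = Σ_{n=0}^∞ G₀Rⁿ"*, (3.130) p. 421, p. 422 *"we replace each operator in (3.130) by its random walk
expansion"*, (3.107)–(3.108) p. 416: THE NEUMANN FAMILY OF WALK TERMS AT THE MATRIX-ENTRY LEVEL — CHAINS of step terms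
over a seed term: the per-chain bound at ONE chain rate on the concatenated walk distance (3.93), UNIFORM partial-sum
majorants of the whole (chain, seed) family with the constant `Ā(1 − q)⁻¹` (no walk counting), the LEVEL sums `K^N·C`,
their convergence, the death of the remainder `K^N·C → 0`, and the resolvent identity `(1 − K)·X = C` for the family's sum

statement-level bookkeeping over published theorems with citation tags; kernel-checked; nothing here is a claim about
the Yang–Mills mass gap.

PROVENANCE ∕ WHY (cell `pub-ymgap`, D-0062 Track A, node N10 = [B13]; seat `pub-ymgap-dag-n10-c` g4, module 26a;
FAN-OUT v1.1 §N10 s1 ≡ §N06 s4 «NODE A's object content: `JointWalkExpansion`s for `G_k(U)`-built kernels — START-HERE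
`B9SectDWalk.neumann_majSumLe`»).  The tree's [B9] Sect. D walk algebra `B9SectDWalk` (chains `chainConst ∕ chainDist ∕
chainMaj`, `neumann_majSumLe`) is stated for linear maps with block norms; the N10 ∕ NODE-O currency
`B13JointWalkExpansion.JointWalkExpansion` is complex matrix ENTRIES.  The entry-level transport exists Summit-side
(cell `pub-balaban-gaps`, seat ne5 gen 5: `Spine/NE5/NeumannChainWalks` + `Spine/NE5/NeumannLevelSums`, the building
blocks of its T9 `NeumannPencilCovariance`), which Literature cannot import.  THIS FILE is the LITERATURE HOME of those
two modules — declarations adapted statement-by-statement (namespace moved here; the product tools read from type-B13's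
`B13JointWalkExpansionAlgebra.norm_mul_entry_le_of_walks ∕ exp_infConv_le_sum` instead of `Spine/NE5/ProductWalks`) —
so that the NEUMANN ∕ INVERSE closure of the joint-walk-expansion shape (`B13JointWalkExpansionNeumann`, module 26b) and,
after it, [13] Thm 3.10's mechanism «parametrix × (I − R)⁻¹» for `G_k(U)`-built kernels can be stated in Literature.

WHAT THIS FILE PROVES (all `theorem`s; geometry `toB6 (torusGeom Nf 0 0 0) 0 True` = the one-scale ℓ¹ site torus).
§1 `chainDist_nonneg`, ★ `norm_chain_entry_le` — steps `‖S_i a b‖ ≤ θ_i e^{−δD_i}` (`D_i ≥ d₁`), seed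
   `‖T₀ a b‖ ≤ A e^{−ρD₀}`, fibre multiplicity `m`, row sum (2.61) at rate `σ`, `ρ + σ ≤ δ` ⟹ the chain `S_{i₁}⋯S_{iₙ}T₀`
   is bounded entrywise by `chainConst m c θ A l · e^{−ρ·chainDist D D₀ l}` (every step pays its own junction from its
   excess rate; the chain keeps the rate `ρ`, [B9] p. 410).
§2 `chain_majorant_le_chainMaj` — the exponential chain majorant is dominated by `B9SectDWalk.chainMaj` of the step ∕ seed
   majorant families at any rates `≤ ρ`; ★ `majSumLe_chain` — by `B9SectDWalk.neumann_majSumLe`: partial sums of the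
   whole (chain, seed) family `≤ Ā(1 − q)⁻¹e^{−κd}`, `q = (mc)·θ̄·c′ < 1`, uniformly in the chain length.
§3 ★ `hasSum_chain_level` (the chains of length `N` sum entrywise to `K^N·C`, Cauchy product per
   middle index), ★ `hasSum_levels` (`Σ_N K^N·C` converges entrywise to the family's sum), `tendsto_level_zero`
   (`K^N·C → 0`), ★ `one_sub_mul_tsum_eq` (`(1 − K)·X = C`, telescoping).
HONEST FRAMING: bookkeeping (finite matrices, absolutely convergent series of entries) over HYPOTHESIS data — the step ∕
seed families and every constant are binders; NOTHING of Bałaban's `G_k`, `Δ_k`, `C^{(k)}` is constructed or asserted;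
(D4) ∕ NODE A NOT discharged; count-neutral; NOT a discharge of N10; no `sorry`, no `def`, no new named fact; standard
axioms; nothing continuum ∕ ℝ⁴ ∕ OS ∕ mass gap ∕ Clay.
-/

noncomputable section

namespace Literature.MathematicalPhysics.QuantumFieldTheory.Balaban1983to89.B13NeumannChains

open Metric Set Finset
open Literature.MathematicalPhysics.QuantumFieldTheory.Balaban1983to89
open Literature.MathematicalPhysics.QuantumFieldTheory.Balaban1983to89.B9SectDWalk
  (Through MajSumLe DomBy infConv conv chainConst chainDist chainMaj)
open Literature.MathematicalPhysics.QuantumFieldTheory.Balaban1983to89.B9Thm34Ext (toB6)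
open Literature.MathematicalPhysics.QuantumFieldTheory.Balaban1983to89.B9Thm37GlueTorus
  (torusGeom tdist1 tdist1_nonneg hdnn_torusGeom htri_torusGeom)
open Literature.MathematicalPhysics.QuantumFieldTheory.Balaban1983to89.B5TorusCover (UT)
open Literature.MathematicalPhysics.QuantumFieldTheory.Balaban1983to89.B11SectG (RowSum)
open Literature.MathematicalPhysics.QuantumFieldTheory.Balaban1983to89.B13JointWalkExpansionAlgebra
  (norm_mul_entry_le_of_walks exp_infConv_le_sum)

variable {ν : ℕ} {Nf : Fin ν → ℕ} [∀ i, NeZero (Nf i)]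
variable {ι n q : Type} [Fintype n]

/-! ## §1. Per-term bound of a chain of step matrices over a seed -/

/-- The chain distance (3.93) of a concatenated walk is non-negative when the step and seed distances dominate `d₁ ≥ 0`
((2.54) at every junction; Literature twin of the Summit-side `Spine/NE5/NeumannChainWalks.chainDist_nonneg`). [cite: Balaban1985BackgroundPropagators, (3.93) p.410; Balaban1984PropagatorsII, (2.54) p.233] -/
theorem chainDist_nonneg {D : ι → UT Nf → UT Nf → ℝ} {DS : UT Nf → UT Nf → ℝ}
    (hD : ∀ i, DomBy (toB6 (torusGeom Nf 0 0 0) 0 True) (D i)) (hDS : DomBy (toB6 (torusGeom Nf 0 0 0) 0 True) DS)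
    (l : List ι) (a b : UT Nf) : 0 ≤ chainDist (g := toB6 (torusGeom Nf 0 0 0) 0 True) D DS l a b :=
  (hdnn_torusGeom 0 0 0 a b).trans (B9SectDWalk.domBy_chainDist (htri_torusGeom 0 0 0 0 True) hD hDS l a b)

/-- **PER-TERM BOUND OF A CHAIN** ((3.108) shape for a walk of walk terms, entry level; adapted from the Summit-side
`Spine/NE5/NeumannChainWalks.norm_chain_entry_le`): steps `S_i` with `‖S_i a b‖ ≤ θ_i e^{−δD_i(loc a, loc b)}`, `D_i ≥ d₁`;
seed `T₀` with `‖T₀ a b‖ ≤ A e^{−ρD₀(loc a, loc′ b)}`, `D₀ ≥ d₁`; fibre multiplicity `m` of the step locator; row sum at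
rate `σ` with constant `c`; `ρ + σ ≤ δ`.  Then the chain `S_{i₁}⋯S_{iₙ}·T₀` is bounded entrywise by
`chainConst m c θ A l · e^{−ρ·chainDist D D₀ l(loc a, loc′ b)}`: every step pays its own boundary row sum from its excess
rate, the chain keeps the rate `ρ`. [cite: Balaban1985BackgroundPropagators, (3.107)–(3.108) p.416, (3.92)–(3.94) p.410, p.422] -/
theorem norm_chain_entry_le (locn : n → UT Nf) (locq : q → UT Nf) {m : ℕ}
    (hfib : ∀ y : UT Nf, (Finset.univ.filter fun k => locn k = y).card ≤ m)
    {S : ι → Matrix n n ℂ} {T₀ : Matrix n q ℂ} {θ : ι → ℝ} {D : ι → UT Nf → UT Nf → ℝ} {A δ ρ σ c : ℝ}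
    {D₀ : UT Nf → UT Nf → ℝ}
    (hθ : ∀ i, 0 ≤ θ i) (hA : 0 ≤ A) (hρ : 0 ≤ ρ) (hσ : 0 ≤ σ) (hρδ : ρ + σ ≤ δ)
    (hD : ∀ i, DomBy (toB6 (torusGeom Nf 0 0 0) 0 True) (D i)) (hD₀ : DomBy (toB6 (torusGeom Nf 0 0 0) 0 True) D₀)
    (hrow : RowSum (toB6 (torusGeom Nf 0 0 0) 0 True) σ c)
    (hS : ∀ i a b, ‖S i a b‖ ≤ θ i * Real.exp (-(δ * D i (locn a) (locn b))))
    (hT : ∀ a b, ‖T₀ a b‖ ≤ A * Real.exp (-(ρ * D₀ (locn a) (locq b)))) :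
    ∀ (l : List ι) (a : n) (b : q), ‖(l.foldr (fun i M => S i * M) T₀) a b‖ ≤
      chainConst (m : ℝ) c θ A l * Real.exp (-(ρ * chainDist (g := toB6 (torusGeom Nf 0 0 0) 0 True) D D₀ l (locn a) (locq b))) := by
  intro l
  induction l with
  | nil =>
      intro a b
      simpa [chainConst, chainDist] using hT a b
  | cons i l ih =>
      intro a b
      have hc : 0 ≤ c := by
        rcases isEmpty_or_nonempty (UT Nf) with h | ⟨⟨y⟩⟩
        · exact (h.false (locn a)).elim
        · exact B11SectG.RowSum.nonneg hrow y
      have hconst : 0 ≤ chainConst (m : ℝ) c θ A l :=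
        B9SectDWalk.chainConst_nonneg (Nat.cast_nonneg m) hc hθ hA l
      have h := norm_mul_entry_le_of_walks (Nf := Nf) locn locn locq hfib (hθ i) hconst hρ le_rfl hσ hρδ (hD i)
        (chainDist_nonneg hD hD₀ l) hrow (fun a k => hS i a k) (fun k b => ih k b) a b
      simp only [List.foldr_cons, B9SectDWalk.chainConst_cons, B9SectDWalk.chainDist_cons]
      calc ‖(S i * List.foldr (fun i M => S i * M) T₀ l) a b‖
          ≤ (m * c * (θ i * chainConst (m : ℝ) c θ A l)) *
              Real.exp (-(ρ * infConv (g := toB6 (torusGeom Nf 0 0 0) 0 True) (D i)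
                (chainDist (g := toB6 (torusGeom Nf 0 0 0) 0 True) D D₀ l) (locn a) (locq b))) := h
        _ = (m * θ i * chainConst (m : ℝ) c θ A l * c) *
              Real.exp (-(ρ * infConv (g := toB6 (torusGeom Nf 0 0 0) 0 True) (D i)
                (chainDist (g := toB6 (torusGeom Nf 0 0 0) 0 True) D D₀ l) (locn a) (locq b))) := by ring

/-! ## §2. The exponential chain majorant is dominated by the iterated majorant; uniform partial sums -/

/-- **Domination by the iterated majorant** (adapted from `Spine/NE5/NeumannChainWalks.chain_majorant_le_chainMaj`): with
step majorants `mK i = θ_i e^{−rD_i}` and seed majorant `mS = A e^{−r₀D₀}` taken at rates `r, r₀ ≤ ρ` (the DROP windows of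
the factors), the exponential chain majorant at the chain rate `ρ` satisfies
`chainConst m c θ A l · e^{−ρ·chainDist(a,b)} ≤ chainMaj (mc) mK mS l (a,b)` (one term of each convolution sum: the attained
infimum of (3.93)). [cite: Balaban1985BackgroundPropagators, (3.93) p.410, p.422] -/
theorem chain_majorant_le_chainMaj {m : ℕ} {θ : ι → ℝ} {D : ι → UT Nf → UT Nf → ℝ} {A ρ r r₀ c : ℝ}
    {D₀ : UT Nf → UT Nf → ℝ} (hθ : ∀ i, 0 ≤ θ i) (hA : 0 ≤ A) (hc : 0 ≤ c) (hr : r ≤ ρ) (hr₀ : r₀ ≤ ρ)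
    (hD : ∀ i, DomBy (toB6 (torusGeom Nf 0 0 0) 0 True) (D i)) (hD₀ : DomBy (toB6 (torusGeom Nf 0 0 0) 0 True) D₀) :
    ∀ (l : List ι) (a b : UT Nf),
      chainConst (m : ℝ) c θ A l * Real.exp (-(ρ * chainDist (g := toB6 (torusGeom Nf 0 0 0) 0 True) D D₀ l a b)) ≤
        chainMaj (g := toB6 (torusGeom Nf 0 0 0) 0 True) (m * c) (fun i a b => θ i * Real.exp (-(r * D i a b)))
          (fun a b => A * Real.exp (-(r₀ * D₀ a b))) l a b := by
  have hDnn : ∀ i a b, 0 ≤ D i a b := fun i a b => (hdnn_torusGeom 0 0 0 a b).trans (hD i a b)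
  have hD₀nn : ∀ a b, 0 ≤ D₀ a b := fun a b => (hdnn_torusGeom 0 0 0 a b).trans (hD₀ a b)
  intro l
  induction l with
  | nil =>
      intro a b
      simp only [B9SectDWalk.chainConst_nil, B9SectDWalk.chainDist_nil, B9SectDWalk.chainMaj_nil]
      exact mul_le_mul_of_nonneg_left (Real.exp_le_exp.2 (neg_le_neg (mul_le_mul_of_nonneg_right hr₀ (hD₀nn a b)))) hA
  | cons i l ih =>
      intro a b
      simp only [B9SectDWalk.chainConst_cons, B9SectDWalk.chainDist_cons, B9SectDWalk.chainMaj_cons, conv]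
      have hCl : 0 ≤ chainConst (m : ℝ) c θ A l := B9SectDWalk.chainConst_nonneg (Nat.cast_nonneg m) hc hθ hA l
      have hsum := exp_infConv_le_sum (Nf := Nf) (D₁ := D i)
        (D₂ := chainDist (g := toB6 (torusGeom Nf 0 0 0) 0 True) D D₀ l) hr le_rfl (hDnn i)
        (chainDist_nonneg hD hD₀ l) a b
      calc (m : ℝ) * θ i * chainConst (m : ℝ) c θ A l * c *
            Real.exp (-(ρ * infConv (g := toB6 (torusGeom Nf 0 0 0) 0 True) (D i)
              (chainDist (g := toB6 (torusGeom Nf 0 0 0) 0 True) D D₀ l) a b))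
          ≤ (m : ℝ) * θ i * chainConst (m : ℝ) c θ A l * c *
            ∑ y : UT Nf, Real.exp (-(r * D i a y)) *
              Real.exp (-(ρ * chainDist (g := toB6 (torusGeom Nf 0 0 0) 0 True) D D₀ l y b)) :=
            mul_le_mul_of_nonneg_left hsum (mul_nonneg (mul_nonneg (mul_nonneg (Nat.cast_nonneg m) (hθ i)) hCl) hc)
        _ = ∑ y : UT Nf, (θ i * Real.exp (-(r * D i a y))) * ((m * c) *
              (chainConst (m : ℝ) c θ A l * Real.exp (-(ρ * chainDist (g := toB6 (torusGeom Nf 0 0 0) 0 True) D D₀ l y b)))) := by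
            rw [Finset.mul_sum]; exact Finset.sum_congr rfl fun y _ => by ring
        _ ≤ ∑ y : UT Nf, (θ i * Real.exp (-(r * D i a y))) * ((m * c) *
              chainMaj (g := toB6 (torusGeom Nf 0 0 0) 0 True) (m * c) (fun i a b => θ i * Real.exp (-(r * D i a b)))
                (fun a b => A * Real.exp (-(r₀ * D₀ a b))) l y b) :=
            Finset.sum_le_sum fun y _ => mul_le_mul_of_nonneg_left
              (mul_le_mul_of_nonneg_left (ih y b) (mul_nonneg (Nat.cast_nonneg m) hc)) (mul_nonneg (hθ i) (Real.exp_nonneg _))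

/-- **SUMMABILITY OF THE NEUMANN FAMILY WITH THE CONSTANT `Ā(1 − q)⁻¹`** (entry level; `B9SectDWalk.neumann_majSumLe` BY
NAME; adapted from `Spine/NE5/NeumannChainWalks.majSumLe_chain`): step TERM family `i ∈ ι` with majorants `θ_i e^{−rD_i}`
whose partial sums are `≤ θ̄e^{−δ′d}`, seed family `ω ∈ W₀` with majorants `A_ω e^{−r₀D₀,ω}` whose partial sums are
`≤ Āe^{−ρ_S d}`, all walk distances dominating `d₁`, rates `r, r₀ ≤ ρ`, torus rates `κ ≤ ρ_S`, `κ + σ′ ≤ δ′`, and the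
SMALLNESS `q := (mc)·θ̄·c′ < 1`.  Then for EVERY finite set of (chain, seed) pairs the exponential chain majorants at rate
`ρ` sum to at most `Ā(1 − q)⁻¹·e^{−κd}` — uniformly in the chain length; no walk counting.
[cite: Balaban1985BackgroundPropagators, p.422 (after (3.131)), Thm 3.12 p.423; Balaban1984PropagatorsII, Lemma 2.1 p.234] -/
theorem majSumLe_chain {W₀ : Type} {m : ℕ} {θ : ι → ℝ} {D : ι → UT Nf → UT Nf → ℝ} {A₀ : W₀ → ℝ}
    {D₀ : W₀ → UT Nf → UT Nf → ℝ} {ρ r r₀ c θbar Abar δ' ρS κ σ' c' : ℝ}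
    (hθ : ∀ i, 0 ≤ θ i) (hA₀ : ∀ ω, 0 ≤ A₀ ω) (hc : 0 ≤ c) (hr : r ≤ ρ) (hr₀ : r₀ ≤ ρ)
    (hD : ∀ i, DomBy (toB6 (torusGeom Nf 0 0 0) 0 True) (D i))
    (hD₀ : ∀ ω, DomBy (toB6 (torusGeom Nf 0 0 0) 0 True) (D₀ ω))
    (hrow' : RowSum (toB6 (torusGeom Nf 0 0 0) 0 True) σ' c') (hσ' : 0 ≤ σ')
    (hθbar : 0 ≤ θbar) (hAbar : 0 ≤ Abar) (hκ : 0 ≤ κ) (hκS : κ ≤ ρS) (hκδ : κ + σ' ≤ δ')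
    (hK : MajSumLe (g := toB6 (torusGeom Nf 0 0 0) 0 True) (fun i a b => θ i * Real.exp (-(r * D i a b)))
      (fun a b => θbar * Real.exp (-(δ' * tdist1 Nf a b))))
    (hS : MajSumLe (g := toB6 (torusGeom Nf 0 0 0) 0 True) (fun ω a b => A₀ ω * Real.exp (-(r₀ * D₀ ω a b)))
      (fun a b => Abar * Real.exp (-(ρS * tdist1 Nf a b))))
    (hq : (m * c) * θbar * c' < 1) :
    MajSumLe (g := toB6 (torusGeom Nf 0 0 0) 0 True)
      (fun (p : List ι × W₀) a b => chainConst (m : ℝ) c θ (A₀ p.2) p.1 *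
        Real.exp (-(ρ * chainDist (g := toB6 (torusGeom Nf 0 0 0) 0 True) D (D₀ p.2) p.1 a b)))
      (fun a b => Abar * (1 - (m * c) * θbar * c')⁻¹ * Real.exp (-(κ * tdist1 Nf a b))) := by
  classical
  have hN := B9SectDWalk.neumann_majSumLe (g := toB6 (torusGeom Nf 0 0 0) 0 True) (κ := m * c)
    (mK := fun i a b => θ i * Real.exp (-(r * D i a b))) (mS := fun ω a b => A₀ ω * Real.exp (-(r₀ * D₀ ω a b)))
    (hdnn_torusGeom 0 0 0) hrow' hσ' (htri_torusGeom 0 0 0 0 True) (mul_nonneg (Nat.cast_nonneg m) hc) hθbar hAbar hκ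
    hκS hκδ (fun i a b => mul_nonneg (hθ i) (Real.exp_nonneg _)) (fun ω a b => mul_nonneg (hA₀ ω) (Real.exp_nonneg _))
    hK hS hq
  intro S a b
  refine (Finset.sum_le_sum fun p _ => ?_).trans (hN S a b)
  exact chain_majorant_le_chainMaj (hθ) (hA₀ p.2) hc hr hr₀ hD (hD₀ p.2) p.1 a b

/-! ## §3. Level sums `K^N·C`, their convergence, and the resolvent identity `(1 − K)·X = C` -/

section Levels

variable {W₀ : Type} [DecidableEq n]

omit [Fintype n] [DecidableEq n] in
/-- **Summability of an entry family from bounded partial sums of real majorants** (twin of the Summit-side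
`Spine/NE5/NeumannLevelSums.summable_of_majorant`). [folklore] -/
private theorem summable_of_majorant {W : Type} {f : W → ℂ} {g : W → ℝ} (hle : ∀ ω, ‖f ω‖ ≤ g ω) {B : ℝ}
    (hsum : ∀ S : Finset W, ∑ ω ∈ S, g ω ≤ B) : Summable f :=
  Summable.of_norm_bounded (summable_of_sum_le (fun ω => (norm_nonneg _).trans (hle ω)) hsum) hle

/-- **THE LEVEL-`N` SUM OF THE CHAIN FAMILY IS `K^N·C`** (entrywise; adapted from `Spine/NE5/NeumannLevelSums.hasSum_chain_level`).
Steps `S_i` (square) with `Σ_i S_i = K` entrywise and real majorants `‖S_i a b‖ ≤ σ_i(a,b)` with bounded partial sums;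
seeds `T_ω` with `Σ_ω T_ω = C` entrywise; and for every length `N` a real majorant `M_N` of the chains
`‖(List.ofFn v).foldr (S · * ·) (T ω) a b‖ ≤ M_N (v, ω) a b` with bounded partial sums over finite sets of
`(Fin N → ι) × W₀` (supplied by `norm_chain_entry_le` ∕ `majSumLe_chain`).  Then for every `N`:
`HasSum (fun (v, ω) => ((List.ofFn v).foldr (S · * ·) (T ω)) a b) ((K ^ N * C) a b)` — [B9] p. 422 read backwards:
«replace each operator by its random walk expansion» = distributivity (Cauchy product per middle index).
[cite: Balaban1985BackgroundPropagators, (3.130) p.421, p.422] -/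
theorem hasSum_chain_level {S : ι → Matrix n n ℂ} {K : Matrix n n ℂ} {T : W₀ → Matrix n q ℂ} {C : Matrix n q ℂ}
    (hS : ∀ a k, HasSum (fun i => S i a k) (K a k))
    {σS : ι → n → n → ℝ} (hσS : ∀ i a k, ‖S i a k‖ ≤ σS i a k) {BS : n → n → ℝ}
    (hBS : ∀ (F : Finset ι) a k, ∑ i ∈ F, σS i a k ≤ BS a k)
    (hT : ∀ k b, HasSum (fun ω => T ω k b) (C k b))
    {M : (N : ℕ) → ((Fin N → ι) × W₀) → n → q → ℝ}
    (hM : ∀ N (v : (Fin N → ι) × W₀) k b, ‖((List.ofFn v.1).foldr (fun i A => S i * A) (T v.2)) k b‖ ≤ M N v k b)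
    {BM : ℕ → n → q → ℝ} (hBM : ∀ N (F : Finset ((Fin N → ι) × W₀)) k b, ∑ v ∈ F, M N v k b ≤ BM N k b) :
    ∀ (N : ℕ) (a : n) (b : q),
      HasSum (fun v : (Fin N → ι) × W₀ => ((List.ofFn v.1).foldr (fun i A => S i * A) (T v.2)) a b) ((K ^ N * C) a b) := by
  intro N
  induction N with
  | zero =>
      intro a b
      -- chains of length 0 are the seeds
      let e : W₀ ≃ (Fin 0 → ι) × W₀ := (Equiv.uniqueProd W₀ (Fin 0 → ι)).symm
      rw [← e.hasSum_iff]
      have hfun : (fun v : (Fin 0 → ι) × W₀ => ((List.ofFn v.1).foldr (fun i A => S i * A) (T v.2)) a b) ∘ e =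
          fun ω => T ω a b := by
        funext ω
        simp [e, Equiv.uniqueProd, List.ofFn_zero]
      rw [hfun, pow_zero, Matrix.one_mul]
      exact hT a b
  | succ N ih =>
      intro a b
      -- reindex chains of length N+1 as (first step, chain of length N)
      let e : ι × ((Fin N → ι) × W₀) ≃ (Fin (N + 1) → ι) × W₀ :=
        (Equiv.prodAssoc ι (Fin N → ι) W₀).symm.trans ((Fin.consEquiv fun _ => ι).prodCongr (Equiv.refl W₀))
      rw [← e.hasSum_iff]
      have hfun : (fun v : (Fin (N + 1) → ι) × W₀ => ((List.ofFn v.1).foldr (fun i A => S i * A) (T v.2)) a b) ∘ e =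
          fun p : ι × ((Fin N → ι) × W₀) =>
            ∑ k, S p.1 a k * ((List.ofFn p.2.1).foldr (fun i A => S i * A) (T p.2.2)) k b := by
        funext p
        simp only [Function.comp_apply, e, Equiv.trans_apply, Equiv.prodCongr_apply, Equiv.prodAssoc_symm_apply,
          Prod.map_apply, Equiv.refl_apply, Fin.consEquiv, Equiv.coe_fn_mk, List.ofFn_succ, Fin.cons_zero, Fin.cons_succ,
          List.foldr_cons, Matrix.mul_apply]
      rw [hfun, pow_succ', Matrix.mul_assoc, Matrix.mul_apply]
      refine hasSum_sum fun k _ => ?_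
      -- Cauchy product of the step expansion at (a,k) with the level-N chain sum at (k,b)
      have hf : Summable fun i : ι => σS i a k := summable_of_sum_le (fun i => (norm_nonneg _).trans (hσS i a k))
        fun F => hBS F a k
      have hg : Summable fun v : (Fin N → ι) × W₀ => M N v k b :=
        summable_of_sum_le (fun v => (norm_nonneg _).trans (hM N v k b)) fun F => hBM N F k b
      let f : ι → ℂ := fun i => S i a k
      let g : (Fin N → ι) × W₀ → ℂ := fun v => ((List.ofFn v.1).foldr (fun i A => S i * A) (T v.2)) k b
      have hfg : Summable fun x : ι × ((Fin N → ι) × W₀) => f x.1 * g x.2 := by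
        refine Summable.of_norm_bounded (hf.mul_of_nonneg hg (fun i => (norm_nonneg _).trans (hσS i a k))
          (fun v => (norm_nonneg _).trans (hM N v k b))) fun x => ?_
        exact (norm_mul_le (f x.1) (g x.2)).trans
          (mul_le_mul (hσS x.1 a k) (hM N x.2 k b) (norm_nonneg _) ((norm_nonneg _).trans (hσS x.1 a k)))
      exact HasSum.mul (f := f) (g := g) (hS a k) (ih k b) hfg

/-- **THE LEVELS SUM UP** (adapted from `Spine/NE5/NeumannLevelSums.hasSum_levels`): absolute summability of the whole
(chain, seed) family over `List ι × W₀` — from a real majorant `Mtot` of the chain terms whose partial sums are bounded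
(`norm_chain_entry_le` + `majSumLe_chain`) — ⟹ the family is summable entrywise and `Σ_N K^N·C` converges entrywise to
its sum (`HasSum.sigma` through «(length, tuple, seed) ≃ (list, seed)», `List.equivSigmaTuple`).
[cite: Balaban1985BackgroundPropagators, (3.130) p.421, p.422, p.416 (after (3.108))] -/
theorem hasSum_levels {S : ι → Matrix n n ℂ} {K : Matrix n n ℂ} {T : W₀ → Matrix n q ℂ} {C : Matrix n q ℂ}
    (hS : ∀ a k, HasSum (fun i => S i a k) (K a k))
    {σS : ι → n → n → ℝ} (hσS : ∀ i a k, ‖S i a k‖ ≤ σS i a k) {BS : n → n → ℝ}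
    (hBS : ∀ (F : Finset ι) a k, ∑ i ∈ F, σS i a k ≤ BS a k)
    (hT : ∀ k b, HasSum (fun ω => T ω k b) (C k b))
    {Mtot : List ι × W₀ → n → q → ℝ}
    (hMtot : ∀ (p : List ι × W₀) k b, ‖(p.1.foldr (fun i A => S i * A) (T p.2)) k b‖ ≤ Mtot p k b)
    {Btot : n → q → ℝ} (hBtot : ∀ (F : Finset (List ι × W₀)) k b, ∑ p ∈ F, Mtot p k b ≤ Btot k b) (a : n) (b : q) :
    Summable (fun p : List ι × W₀ => (p.1.foldr (fun i A => S i * A) (T p.2)) a b) ∧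
    HasSum (fun N : ℕ => (K ^ N * C : Matrix n q ℂ) a b) (∑' p : List ι × W₀, (p.1.foldr (fun i A => S i * A) (T p.2)) a b) := by
  classical
  have hsum : ∀ a b, Summable (fun p : List ι × W₀ => (p.1.foldr (fun i A => S i * A) (T p.2)) a b) :=
    fun a b => summable_of_majorant (fun p => hMtot p a b) (fun F => hBtot F a b)
  -- level majorants: restrict the total majorant along the injection `v ↦ List.ofFn v`
  have hlev := hasSum_chain_level hS hσS hBS hT
    (M := fun N v k b => Mtot (List.ofFn v.1, v.2) k b) (fun N v k b => hMtot (List.ofFn v.1, v.2) k b)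
    (BM := fun _ k b => Btot k b) (by
      intro N F k b
      have hinj : Set.InjOn (fun v : (Fin N → ι) × W₀ => ((List.ofFn v.1, v.2) : List ι × W₀)) ↑F := by
        intro v _ w _ h
        simp only [Prod.mk.injEq, List.ofFn_inj] at h
        exact Prod.ext h.1 h.2
      rw [← Finset.sum_image (f := fun p : List ι × W₀ => Mtot p k b) hinj]
      exact hBtot _ k b)
  refine ⟨hsum a b, ?_⟩
  -- reindex the total family by (length, tuple, seed) and sum the fibres
  let e : (Σ N : ℕ, (Fin N → ι) × W₀) ≃ List ι × W₀ :=
    (Equiv.sigmaProdDistrib (fun N : ℕ => Fin N → ι) W₀).symm.trans (List.equivSigmaTuple.symm.prodCongr (Equiv.refl W₀))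
  have he : ∀ p, e p = (List.ofFn p.2.1, p.2.2) := fun _ => rfl
  have htot : HasSum ((fun p : List ι × W₀ => (p.1.foldr (fun i A => S i * A) (T p.2)) a b) ∘ e)
      (∑' p : List ι × W₀, (p.1.foldr (fun i A => S i * A) (T p.2)) a b) :=
    (Equiv.hasSum_iff e).2 (hsum a b).hasSum
  refine htot.sigma fun N => ?_
  simpa [Function.comp, he] using hlev N a b

/-- **THE NEUMANN REMAINDER DIES** (adapted from `Spine/NE5/NeumannLevelSums.tendsto_level_zero`): under the same data
`(K^N·C) a b → 0` — the level-`N` sum is bounded by the level-`N` part of a summable non-negative family (the total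
majorant), whose level sums tend to zero ([B9] p. 414: *"For M sufficiently large this implies G = G₀(I − R)⁻¹ = Σ G₀Rⁿ"*).
[cite: Balaban1985BackgroundPropagators, (3.106) p.414, (3.130) p.421] -/
theorem tendsto_level_zero {S : ι → Matrix n n ℂ} {K : Matrix n n ℂ} {T : W₀ → Matrix n q ℂ} {C : Matrix n q ℂ}
    (hS : ∀ a k, HasSum (fun i => S i a k) (K a k))
    {σS : ι → n → n → ℝ} (hσS : ∀ i a k, ‖S i a k‖ ≤ σS i a k) {BS : n → n → ℝ}
    (hBS : ∀ (F : Finset ι) a k, ∑ i ∈ F, σS i a k ≤ BS a k)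
    (hT : ∀ k b, HasSum (fun ω => T ω k b) (C k b))
    {Mtot : List ι × W₀ → n → q → ℝ}
    (hMtot : ∀ (p : List ι × W₀) k b, ‖(p.1.foldr (fun i A => S i * A) (T p.2)) k b‖ ≤ Mtot p k b)
    {Btot : n → q → ℝ} (hBtot : ∀ (F : Finset (List ι × W₀)) k b, ∑ p ∈ F, Mtot p k b ≤ Btot k b) (a : n) (b : q) :
    Filter.Tendsto (fun N : ℕ => (K ^ N * C : Matrix n q ℂ) a b) Filter.atTop (nhds 0) := by
  classical
  -- the total majorant, reindexed by (length, tuple, seed), is summable; its level sums are summable in N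
  let e : (Σ N : ℕ, (Fin N → ι) × W₀) ≃ List ι × W₀ :=
    (Equiv.sigmaProdDistrib (fun N : ℕ => Fin N → ι) W₀).symm.trans (List.equivSigmaTuple.symm.prodCongr (Equiv.refl W₀))
  have he : ∀ p, e p = (List.ofFn p.2.1, p.2.2) := fun _ => rfl
  have hG : Summable ((fun p : List ι × W₀ => Mtot p a b) ∘ e) :=
    (Equiv.summable_iff e).2 (summable_of_sum_le (fun p => (norm_nonneg _).trans (hMtot p a b)) fun F => hBtot F a b)
  have hGσ := hG.hasSum
  -- level-N majorant family and its sum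
  have hlevG : ∀ N : ℕ, Summable fun v : (Fin N → ι) × W₀ => Mtot (List.ofFn v.1, v.2) a b := fun N =>
    (hG.comp_injective (sigma_mk_injective (i := N))).congr fun v => by simp [Function.comp, he]
  have hm : HasSum (fun N : ℕ => ∑' v : (Fin N → ι) × W₀, Mtot (List.ofFn v.1, v.2) a b) (∑' p, ((fun p : List ι × W₀ => Mtot p a b) ∘ e) p) :=
    hGσ.sigma fun N => by simpa [Function.comp, he] using (hlevG N).hasSum
  have hm0 := hm.summable.tendsto_atTop_zero
  -- the level-N sum of the chain family is bounded by the level-N majorant sum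
  have hlev := hasSum_chain_level hS hσS hBS hT
    (M := fun N v k b => Mtot (List.ofFn v.1, v.2) k b) (fun N v k b => hMtot (List.ofFn v.1, v.2) k b)
    (BM := fun _ k b => Btot k b) (by
      intro N F k b
      have hinj : Set.InjOn (fun v : (Fin N → ι) × W₀ => ((List.ofFn v.1, v.2) : List ι × W₀)) ↑F := by
        intro v _ w _ h
        simp only [Prod.mk.injEq, List.ofFn_inj] at h
        exact Prod.ext h.1 h.2
      rw [← Finset.sum_image (f := fun p : List ι × W₀ => Mtot p k b) hinj]
      exact hBtot _ k b)
  have hbound : ∀ N : ℕ, ‖(K ^ N * C : Matrix n q ℂ) a b‖ ≤ ∑' v : (Fin N → ι) × W₀, Mtot (List.ofFn v.1, v.2) a b :=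
    fun N => (hlev N a b).norm_le_of_bounded (hlevG N).hasSum fun v => hMtot (List.ofFn v.1, v.2) a b
  exact squeeze_zero_norm hbound hm0

/-- **THE RESOLVENT IDENTITY `(1 − K)·X = C`** for the family's sum `X` (entrywise `Σ' (l,ω) chain(l,ω)`; adapted from
`Spine/NE5/NeumannLevelSums.one_sub_mul_tsum_eq`), since the Neumann remainder dies (`tendsto_level_zero`): telescoping
`(1 − K)·Σ_{N<M} K^N C = C − K^M C`. [cite: Balaban1985BackgroundPropagators, (3.106) p.414, (3.130) p.421] -/
theorem one_sub_mul_tsum_eq {S : ι → Matrix n n ℂ} {K : Matrix n n ℂ} {T : W₀ → Matrix n q ℂ} {C : Matrix n q ℂ}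
    (hS : ∀ a k, HasSum (fun i => S i a k) (K a k))
    {σS : ι → n → n → ℝ} (hσS : ∀ i a k, ‖S i a k‖ ≤ σS i a k) {BS : n → n → ℝ}
    (hBS : ∀ (F : Finset ι) a k, ∑ i ∈ F, σS i a k ≤ BS a k)
    (hT : ∀ k b, HasSum (fun ω => T ω k b) (C k b))
    {Mtot : List ι × W₀ → n → q → ℝ}
    (hMtot : ∀ (p : List ι × W₀) k b, ‖(p.1.foldr (fun i A => S i * A) (T p.2)) k b‖ ≤ Mtot p k b)
    {Btot : n → q → ℝ} (hBtot : ∀ (F : Finset (List ι × W₀)) k b, ∑ p ∈ F, Mtot p k b ≤ Btot k b) :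
    (1 - K) * (Matrix.of fun k b => ∑' p : List ι × W₀, (p.1.foldr (fun i A => S i * A) (T p.2)) k b) = C := by
  classical
  set X : Matrix n q ℂ := Matrix.of fun k b => ∑' p : List ι × W₀, (p.1.foldr (fun i A => S i * A) (T p.2)) k b with hX
  have hlev : ∀ k b, HasSum (fun N : ℕ => (K ^ N * C : Matrix n q ℂ) k b) (X k b) := fun k b =>
    (hasSum_levels hS hσS hBS hT hMtot hBtot k b).2
  have hrem : ∀ k b, Filter.Tendsto (fun N : ℕ => (K ^ N * C : Matrix n q ℂ) k b) Filter.atTop (nhds 0) :=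
    fun k b => tendsto_level_zero hS hσS hBS hT hMtot hBtot k b
  ext a b
  -- the entry (a,b) of (1 − K)·X as a sum over the levels
  have h1 : HasSum (fun N : ℕ => ∑ k, (1 - K : Matrix n n ℂ) a k * (K ^ N * C : Matrix n q ℂ) k b) (((1 - K) * X : Matrix n q ℂ) a b) := by
    rw [Matrix.mul_apply]
    exact hasSum_sum fun k _ => (hlev k b).mul_left _
  have h2 : ∀ N : ℕ, ∑ k, (1 - K : Matrix n n ℂ) a k * (K ^ N * C : Matrix n q ℂ) k b =
      (K ^ N * C : Matrix n q ℂ) a b - (K ^ (N + 1) * C : Matrix n q ℂ) a b := by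
    intro N
    rw [← Matrix.mul_apply, Matrix.sub_mul, Matrix.one_mul, Matrix.sub_apply, pow_succ', Matrix.mul_assoc]
  simp_rw [h2] at h1
  -- partial sums telescope to `C a b − (K^M C) a b`, which tends to `C a b`
  have h3 : Filter.Tendsto (fun M : ℕ => ∑ N ∈ Finset.range M, ((K ^ N * C : Matrix n q ℂ) a b - (K ^ (N + 1) * C : Matrix n q ℂ) a b))
      Filter.atTop (nhds (((1 - K) * X : Matrix n q ℂ) a b)) := h1.tendsto_sum_nat
  have h4 : (fun M : ℕ => ∑ N ∈ Finset.range M, ((K ^ N * C : Matrix n q ℂ) a b - (K ^ (N + 1) * C : Matrix n q ℂ) a b)) =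
      fun M => (K ^ 0 * C : Matrix n q ℂ) a b - (K ^ M * C : Matrix n q ℂ) a b := by
    funext M
    exact Finset.sum_range_sub' (fun N => (K ^ N * C : Matrix n q ℂ) a b) M
  rw [h4] at h3
  have h5 : Filter.Tendsto (fun M : ℕ => (K ^ 0 * C : Matrix n q ℂ) a b - (K ^ M * C : Matrix n q ℂ) a b) Filter.atTop
      (nhds ((K ^ 0 * C : Matrix n q ℂ) a b - 0)) :=
    tendsto_const_nhds.sub (hrem a b)
  have h6 := tendsto_nhds_unique h3 h5
  rw [h6, sub_zero, pow_zero, Matrix.one_mul]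

end Levels

end Literature.MathematicalPhysics.QuantumFieldTheory.Balaban1983to89.B13NeumannChains

end
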